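import Summits.SmoothPoincare4.SmoothPoincare4.Theorems.EntropyRungNoncompactShrinkerGapLipschitzSmoothingCompactSupport
import Summits.SmoothPoincare4.SmoothPoincare4.Theorems.EntropyRungNoncompactShrinkerGapMetricCutoffComplete
import Summits.SmoothPoincare4.SmoothPoincare4.Theorems.EntropyRungNoncompactShrinkerGapCsLSIAllScales
import Summits.SmoothPoincare4.SmoothPoincare4.Theorems.EntropyRungNoncompactShrinkerGapCsEntropyCutoff
import Literature.Geometry.Riemannian.CanonicalNeighbourhoodsProofs
import HarnessLib

/-!
# Perelman's `κ`-noncollapsing of a complete gradient shrinking soliton with bounded scalar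
# curvature, uniform in the base point (crux `EntropyRung.NoncompactShrinkerGap`,
# stmt-SmoothPoincare4-10868, line `collapsed-ends-usc`, lead c15, cycle 15)

Brick 2 of the printed chain of the route item `ShrinkerSplittingAtInfinity` (stmt-16588): the
input "non-collapsing" of Hamilton–Cheeger–Gromov compactness at escaping base points. For a
complete connected gradient shrinking Ricci soliton `(Mⁿ, g, f)`, `Ric + Hess f = g/2`, normalised by
`R + |∇f|² = f` (closed `g`-balls compact), with `R ≤ A`, there is `κ > 0` such that
`κ sⁿ ≤ Vol B(x, s)` for EVERY `x ∈ M` and EVERY `0 < s ≤ 1` (`helper_shrinkerNoncollapsing`).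

Proof (Perelman 2002, §4 / Topping 2006, §8.3, run on the complete non-compact soliton, where the
monotone quantity is replaced by the logarithmic Sobolev inequality of the shrinker at all scales):
* `helper_csLSI_allScales` (W3, Li–Wang 2020 Thm. 1.1 in compact-support `𝒲`-form, from the
  discharged named fact `liWang2020_shrinkerLSI_allScales_holds`):
  `log Θ ≤ F_τ(w) = (∫ (τ(R w² + 4|∇w|²) − w² log w²))/Z + log Z + log (4πτ)^{-n/2} − n`;
* `helper_metricCutoffComplete_of` ∘ `helper_lipschitzSmoothingCompactSupport` (W2 ∘ W1): smooth
  cut-offs `χ` adapted to `B(x, s/2) ⊆ B(x, s)` with `|∇χ|² ≤ C₀/s²` on a complete manifold;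
* `helper_csEntropy_cutoff_le_of_integrableOn` (W4, Topping's Lemma 8.3.5 in compact-support form):
  `F_τ(χ) ≤ 4τK (V₁ − V₂)/V₂ + (τ/V₂) ∫_{B₁}|R| + log (V₁/(4πτ)^{n/2}) − n`;
* here: `0 ≤ R ≤ A` (`shrinkerScalarCurvature_nonneg_holds`) gives `∫_{B₁}|R| ≤ A V₁`, the
  real-variable core `mul_pow_le_of_entropy_estimate_sup` (Topping (8.3.8)–(8.3.11) with the
  curvature term bounded by `A 2ⁿ⁺¹/36` at scales `s ≤ 1`) gives the doubling dichotomy with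
  `ξ = (π/9)^{n/2} exp (log Θ + n − (C₀/9 + A/36) 2ⁿ⁺¹)`, and the tree's halving iteration
  `ofReal_mul_pow_le_vol_ball_of_doubling` (small balls are Euclidean) concludes.

No curvature hypothesis beyond `R ≤ A` enters (Munteanu–Wang's `|Rm| ≤ cR` is not used).

## References

* G. Perelman, *The entropy formula for the Ricci flow and its geometric applications*,
  arXiv:math/0211159 (2002), §4, Thm. 4.1. [Perelman2002]
* P. Topping, *Lectures on the Ricci flow*, LMS LNS 325, CUP 2006, §8.3, Thm. 8.3.1, Lemma 8.3.5,
  (8.3.8)–(8.3.11). [Topping2006]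
* Y. Li, B. Wang, *Heat kernel on Ricci shrinkers*, Calc. Var. PDE 59 (2020), Thm. 1.1. [LiWang2020]
* B.-L. Chen, *Strong uniqueness of the Ricci flow*, JDG 82 (2009), Cor. 2.5 (`R ≥ 0`). [Chen2009]
-/

noncomputable section

set_option linter.dupNamespace false

open scoped Manifold ContDiff ENNReal NNReal Topology
open MeasureTheory Set Filter Module
open Literature.Geometry.Lorentzian Literature.Geometry.Riemannian

namespace Summit.SmoothPoincare4.SmoothPoincare4.Theorems.NoncompactShrinkerGapNoncollapsing

/-! ## The real-variable core at scales `s ≤ 1` with a sup bound on the curvature term -/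

/-- **Topping's arithmetic (2006, (8.3.8)–(8.3.11)) with the curvature integral bounded by
`A · V₁`.** From `m ≤ a (V₁ − V₂)/V₂ + (s²/36)/V₂ · J + log [V₁/(4π s²/36)^{n/2}] − n`,
`J ≤ A V₁` (`A ≥ 0`), `s ≤ 1` and the doubling `V₁ ≤ 2ⁿ⁺¹ V₂` one gets `ξ sⁿ ≤ V₁` with
`ξ = (π/9)^{n/2} exp (m + n − (a + A/36) 2ⁿ⁺¹)` (the tree's `mul_pow_le_of_entropy_estimate'`
has `J ≤ n² s⁻² V₁` instead). [cite: Topping2006, §8.3, (8.3.11) and proof of Thm. 8.3.1] -/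
theorem mul_pow_le_of_entropy_estimate_sup (n : ℕ) {m V₁ V₂ s J a A : ℝ} (hs : 0 < s)
    (hs1 : s ≤ 1) (hV₂ : 0 < V₂) (hV : V₂ ≤ V₁) (ha : 0 ≤ a) (hA : 0 ≤ A)
    (hent : m ≤ a * ((V₁ - V₂) / V₂) + 1 / 36 * s ^ 2 / V₂ * J +
      Real.log (V₁ / (4 * Real.pi * (1 / 36 * s ^ 2)) ^ ((n : ℝ) / 2)) - n)
    (hJ : J ≤ A * V₁) (hdoub : V₁ ≤ 2 ^ (n + 1) * V₂) :
    (Real.pi / 9) ^ ((n : ℝ) / 2) * Real.exp (m + n - (a + A / 36) * 2 ^ (n + 1)) * s ^ n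
      ≤ V₁ := by
  have hV₁ : 0 < V₁ := hV₂.trans_le hV
  have hπ : 0 < Real.pi / 9 := by positivity
  -- the scale factor `(4π s²/36)^{n/2} = (π/9)^{n/2} sⁿ`
  have hD : (4 * Real.pi * (1 / 36 * s ^ 2)) ^ ((n : ℝ) / 2) =
      (Real.pi / 9) ^ ((n : ℝ) / 2) * s ^ n := by
    have h1 : 4 * Real.pi * (1 / 36 * s ^ 2) = (Real.pi / 9) * s ^ 2 := by ring
    rw [h1, Real.mul_rpow hπ.le (sq_nonneg s)]
    congr 1
    rw [show ((s ^ 2 : ℝ)) = s ^ (2 : ℝ) by norm_cast, ← Real.rpow_mul hs.le,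
      show (2 : ℝ) * ((n : ℝ) / 2) = n by ring, Real.rpow_natCast]
  have hDpos : 0 < (Real.pi / 9) ^ ((n : ℝ) / 2) * s ^ n := by positivity
  -- bound the two ratio terms by `a 2ⁿ⁺¹` and `(A/36) 2ⁿ⁺¹`
  have hratio : V₁ / V₂ ≤ 2 ^ (n + 1) := by rwa [div_le_iff₀ hV₂]
  have hT1 : a * ((V₁ - V₂) / V₂) ≤ a * 2 ^ (n + 1) := by
    refine mul_le_mul_of_nonneg_left ?_ ha
    calc (V₁ - V₂) / V₂ ≤ V₁ / V₂ := by gcongr; linarith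
      _ ≤ 2 ^ (n + 1) := hratio
  have hs2 : s ^ 2 ≤ 1 := by nlinarith
  have hT2 : 1 / 36 * s ^ 2 / V₂ * J ≤ A / 36 * 2 ^ (n + 1) := by
    have hcoef : 0 ≤ 1 / 36 * s ^ 2 / V₂ := by positivity
    calc 1 / 36 * s ^ 2 / V₂ * J ≤ 1 / 36 * s ^ 2 / V₂ * (A * V₁) := by gcongr
      _ = 1 / 36 * s ^ 2 * (A * (V₁ / V₂)) := by field_simp
      _ ≤ 1 / 36 * 1 * (A * 2 ^ (n + 1)) := by gcongr
      _ = A / 36 * 2 ^ (n + 1) := by ring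
  -- hence a lower bound for the logarithm of the volume ratio
  have hlog : m + n - (a + A / 36) * 2 ^ (n + 1) ≤
      Real.log (V₁ / ((Real.pi / 9) ^ ((n : ℝ) / 2) * s ^ n)) := by
    rw [← hD]; linarith
  have hexp := Real.exp_le_exp.2 hlog
  rw [Real.exp_log (div_pos hV₁ hDpos), le_div_iff₀ hDpos] at hexp
  calc (Real.pi / 9) ^ ((n : ℝ) / 2) * Real.exp (m + n - (a + A / 36) * 2 ^ (n + 1)) * s ^ n
      = Real.exp (m + n - (a + A / 36) * 2 ^ (n + 1)) *
          ((Real.pi / 9) ^ ((n : ℝ) / 2) * s ^ n) := by ring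
    _ ≤ V₁ := hexp

/-! ## The assembly -/

section Assembly

variable {n : ℕ} {M : Type} [TopologicalSpace M]
  [ChartedSpace (EuclideanSpace ℝ (Fin n)) M] [IsManifold (𝓡 n) ∞ M]

/-- Geodesic balls of a complete metric (closed `g.edist`-balls compact) have finite volume.
[folklore] -/
theorem vol_ball_ne_top_of_complete [T3Space M] [MeasurableSpace M] [BorelSpace M]
    {g : PseudoRiemannianMetric (𝓡 n) ∞ (EuclideanSpace ℝ (Fin n)) (TangentSpace (𝓡 n) : M → Type _)}
    (hg : g.IsRiemannian) (hc : ∀ (x : M) (r : NNReal), IsCompact {y : M | g.edist hg x y ≤ r})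
    (x : M) (ρ : ℝ) : g.vol (g.ball x (ENNReal.ofReal ρ)) ≠ ⊤ := by
  haveI := CarrilloNi2009_shrinkerLSI.isFiniteMeasureOnCompacts_riemVolume hg
  refine (lt_of_le_of_lt (measure_mono ?_) ((hc x ρ.toNNReal).measure_lt_top)).ne
  intro y hy
  rw [PseudoRiemannianMetric.mem_ball, PseudoRiemannianMetric.riemEDist_eq hg] at hy
  exact hy.le

/-- A geodesic ball of a complete metric lies in the compact closed ball of the same radius.
[folklore] -/
theorem ball_subset_closedBall_of_complete
    {g : PseudoRiemannianMetric (𝓡 n) ∞ (EuclideanSpace ℝ (Fin n)) (TangentSpace (𝓡 n) : M → Type _)}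
    (hg : g.IsRiemannian) (x : M) (ρ : ℝ) :
    g.ball x (ENNReal.ofReal ρ) ⊆ {y : M | g.edist hg x y ≤ (ρ.toNNReal : NNReal)} := by
  intro y hy
  rw [PseudoRiemannianMetric.mem_ball, PseudoRiemannianMetric.riemEDist_eq hg] at hy
  exact hy.le

end Assembly

/-- **`κ`-noncollapsing of a complete gradient shrinker with bounded scalar curvature —
conditional form over the three analytic inputs** (cut-offs on complete manifolds, the
compact-support LSI at all scales, Topping's Lemma 8.3.5 in compact-support form WITH the
integrability of `|S|` on the ball). The registered stub `helper_shrinkerNoncollapsing_of` (whose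
third antecedent omits that integrability) follows, and all three inputs are theorems of the tree
(`helper_shrinkerNoncollapsing`). Proof: Perelman 2002 §4 / Topping 2006 §8.3 as in the module
docstring. [cite: Perelman2002, §4, Thm. 4.1] [cite: Topping2006, §8.3, Thm. 8.3.1 and Lemma 8.3.5] -/
theorem helper_shrinkerNoncollapsing_of_integrable
    (hcut : ∃ C₀ : ℝ, ∀ {E : Type} [NormedAddCommGroup E] [NormedSpace ℝ E] [FiniteDimensional ℝ E] {H : Type} [TopologicalSpace H] (I : ModelWithCorners ℝ E H) [I.Boundaryless] (M : Type) [TopologicalSpace M] [T2Space M] [LocallyCompactSpace M] [SigmaCompactSpace M] [T3Space M] [ChartedSpace H M] [IsManifold I ∞ M] (g : PseudoRiemannianMetric I ∞ E (TangentSpace I : M → Type _)) (hg : g.IsRiemannian), (∀ (x : M) (r : NNReal), IsCompact {y : M | g.edist hg x y ≤ r}) → ∀ (p : M) (s : ℝ), 0 < s → ∃ χ : M → ℝ, ContMDiff I 𝓘(ℝ, ℝ) ∞ χ ∧ HasCompactSupport χ ∧ (∀ x, 0 ≤ χ x) ∧ (∀ x, χ x ≤ 1) ∧ (∀ x ∈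 g.ball p (ENNReal.ofReal (s / 2)), χ x = 1) ∧ tsupport χ ⊆ g.ball p (ENNReal.ofReal s) ∧ ∀ x, g.gradSq χ x ≤ C₀ / s ^ 2)
    (hLSI : ∀ (n : ℕ) (M : Type) [TopologicalSpace M] [T2Space M] [SecondCountableTopology M] [ChartedSpace (EuclideanSpace ℝ (Fin n)) M] [IsManifold (𝓡 n) ∞ M] [ConnectedSpace M] [T3Space M] [MeasurableSpace M] [BorelSpace M] (g : PseudoRiemannianMetric (𝓡 n) ∞ (EuclideanSpace ℝ (Fin n)) (TangentSpace (𝓡 n) : M → Type _)) [g.HasLeviCivita] (f : M → ℝ) (hg : g.IsRiemannian), (∀ (x : M) (r : NNReal), IsCompact {y : M | g.edist hg x y ≤ r}) → ContMDiff (𝓡 n) 𝓘(ℝ, ℝ) ∞ f → (∀ (x : M) (X Y : TangentSpace (𝓡 n) x), g.ricci x X Y + g.hessian f x X Y = (1 / 2 : ℝ) * g.val x X Y) → (∀ x : M, g.scalarCurvature x + g.gradSq f x = f x) → ∀ τ : ℝ, 0 < τ → ∀ w : M → ℝ, ContMDiff (𝓡 n) 𝓘(ℝ, ℝ) ∞ w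 → HasCompactSupport w → 0 < ∫ x, w x ^ 2 ∂g.riemVolume → Real.log ((4 * Real.pi) ^ (-(n : ℝ) / 2) * ∫ x, Real.exp (-f x) ∂g.riemVolume) ≤ (∫ x, (τ * (g.scalarCurvature x * w x ^ 2 + 4 * g.gradSq w x) - w x ^ 2 * Real.log (w x ^ 2)) ∂g.riemVolume) / (∫ x, w x ^ 2 ∂g.riemVolume) + Real.log (∫ x, w x ^ 2 ∂g.riemVolume) + Real.log ((4 * Real.pi * τ) ^ (-(n : ℝ) / 2)) - n)
    (h835 : ∀ {E : Type} [NormedAddCommGroup E] [NormedSpace ℝ E] [FiniteDimensional ℝ E] {H : Type} [TopologicalSpace H] (I : ModelWithCorners ℝ E H) (M : Type) [TopologicalSpace M] [T2Space M] [ChartedSpace H M] [IsManifold I ∞ M] [T3Space M] [MeasurableSpace M] [BorelSpace M] (g : PseudoRiemannianMetric I ∞ E (TangentSpace I : M → Type _)) (hg : g.IsRiemannian) (S : M → ℝ), Continuous S → ∀ (p : M) (r τ K : ℝ), 0 < r → 0 < τ → ∀ χ : M → ℝ, ContMDiff I 𝓘(ℝ, ℝ) ∞ χ → HasCompactSupport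 χ → (∀ x, 0 ≤ χ x) → (∀ x, χ x ≤ 1) → (∀ x ∈ g.ball p (ENNReal.ofReal (r / 2)), χ x = 1) → tsupport χ ⊆ g.ball p (ENNReal.ofReal r) → (∀ x, g.gradSq χ x ≤ K) → g.vol (g.ball p (ENNReal.ofReal r)) ≠ ⊤ → IntegrableOn (fun x ↦ |S x|) (g.ball p (ENNReal.ofReal r)) g.riemVolume → (∫ x, (τ * (S x * χ x ^ 2 + 4 * g.gradSq χ x) - χ x ^ 2 * Real.log (χ x ^ 2)) ∂g.riemVolume) / (∫ x, χ x ^ 2 ∂g.riemVolume) + Real.log (∫ x, χ x ^ 2 ∂g.riemVolume) + Real.log ((4 * Real.pi * τ) ^ (-(finrank ℝ E : ℝ) / 2)) - finrank ℝ E ≤ 4 * τ * K * ((((g.vol (g.ball p (ENNReal.ofReal r))).toReal - (g.vol (g.ball p (ENNReal.ofReal (r / 2)))).toReal)) / (g.vol (g.ball p (ENNReal.ofReal (r / 2)))).toReal) + τ / (g.vol (g.ball p (ENNReal.ofReal (r / 2)))).toReal * ∫ x in g.ball p (ENNReal.ofReal r), |S x| ∂g.riemVolume + Real.log ((g.vol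 (g.ball p (ENNReal.ofReal r))).toReal / (4 * Real.pi * τ) ^ ((finrank ℝ E : ℝ) / 2)) - finrank ℝ E) :
    ∀ (n : ℕ) (M : Type) [TopologicalSpace M] [T2Space M] [SecondCountableTopology M] [ChartedSpace (EuclideanSpace ℝ (Fin n)) M] [IsManifold (𝓡 n) ∞ M] [ConnectedSpace M] [T3Space M] [MeasurableSpace M] [BorelSpace M] (g : PseudoRiemannianMetric (𝓡 n) ∞ (EuclideanSpace ℝ (Fin n)) (TangentSpace (𝓡 n) : M → Type _)) [g.HasLeviCivita] (f : M → ℝ) (hg : g.IsRiemannian), (∀ (x : M) (r : NNReal), IsCompact {y : M | g.edist hg x y ≤ r}) → ContMDiff (𝓡 n) 𝓘(ℝ, ℝ) ∞ f → (∀ (x : M) (X Y : TangentSpace (𝓡 n) x), g.ricci x X Y + g.hessian f x X Y = (1 / 2 : ℝ) * g.val x X Y) → (∀ x : M, g.scalarCurvature x + g.gradSq f x = f x) → ∀ A : ℝ, (∀ x : M, g.scalarCurvature x ≤ A) → ∃ κ : ℝ, 0 < κ ∧ ∀ (x : M) (s : ℝ), 0 < s → s ≤ 1 → ENNReal.ofReal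 (κ * s ^ n) ≤ g.vol (g.ball x (ENNReal.ofReal s)) := by
  intro n M _ _ _ _ _ _ _ _ _ g _ f hg hc hf hsol hnorm A hA
  classical
  haveI : LocallyCompactSpace M := Manifold.locallyCompact_of_finiteDimensional (M := M) (𝓡 n)
  haveI : SigmaCompactSpace M := sigmaCompactSpace_of_locallyCompact_secondCountable
  haveI := CarrilloNi2009_shrinkerLSI.isFiniteMeasureOnCompacts_riemVolume hg
  obtain ⟨C₀, hC₀⟩ := hcut
  -- `0 ≤ R ≤ A`
  have hR0 : ∀ x, 0 ≤ g.scalarCurvature x :=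
    shrinkerScalarCurvature_nonneg_holds n M g f hg hc hf hsol hnorm
  obtain ⟨x₀⟩ := (inferInstance : Nonempty M)
  have hA0 : 0 ≤ A := (hR0 x₀).trans (hA x₀)
  have hRc : Continuous fun x ↦ g.scalarCurvature x :=
    (PseudoRiemannianMetric.contMDiff_scalarCurvature g).continuous
  -- the constants
  set C₁ : ℝ := max C₀ 0 with hC₁
  have hC₁0 : 0 ≤ C₁ := le_max_right _ _
  set m : ℝ := Real.log ((4 * Real.pi) ^ (-(n : ℝ) / 2) * ∫ x, Real.exp (-f x) ∂g.riemVolume)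
    with hm
  set ξ : ℝ := (Real.pi / 9) ^ ((n : ℝ) / 2) * Real.exp (m + n - (C₁ / 9 + A / 36) * 2 ^ (n + 1))
    with hξ
  have hξpos : 0 < ξ := by positivity
  refine ⟨ξ, hξpos, fun x s hs hs1 ↦ ?_⟩
  have hfr : finrank ℝ (EuclideanSpace ℝ (Fin n)) = n := finrank_euclideanSpace_fin
  -- the halving iteration: it suffices to prove the doubling dichotomy at every scale `s' ≤ s`
  have key := PseudoRiemannianMetric.ofReal_mul_pow_le_vol_ball_of_doubling (I := 𝓡 n) hg x hs
    hξpos (fun s' hs' hs's hdoub ↦ ?_)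
  · simpa only [hfr] using key
  rw [hfr] at hdoub ⊢
  have hs'1 : s' ≤ 1 := hs's.trans hs1
  -- the cut-off at scale `s'`
  obtain ⟨χ, hχs, hχc, hχ0, hχ1, hχB, hχsupp, hχK⟩ := hC₀ (𝓡 n) M g hg hc x s' hs'
  have hχK' : ∀ y, g.gradSq χ y ≤ C₁ / s' ^ 2 := fun y ↦
    (hχK y).trans (div_le_div_of_nonneg_right (le_max_left _ _) (by positivity))
  -- volumes
  set B₁ := g.ball x (ENNReal.ofReal s') with hB₁
  set B₂ := g.ball x (ENNReal.ofReal (s' / 2)) with hB₂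
  have hfin₁ : g.vol B₁ ≠ ⊤ := vol_ball_ne_top_of_complete hg hc x s'
  have hfin₂ : g.vol B₂ ≠ ⊤ := vol_ball_ne_top_of_complete hg hc x (s' / 2)
  set V₁ := (g.vol B₁).toReal with hV₁
  set V₂ := (g.vol B₂).toReal with hV₂
  have hV₂pos : 0 < V₂ :=
    ENNReal.toReal_pos (vol_ball_pos_corners hg x (ENNReal.ofReal_pos.2 (half_pos hs'))).ne' hfin₂
  have hB₂B₁ : B₂ ⊆ B₁ := g.ball_mono x (ENNReal.ofReal_le_ofReal (by linarith))
  have hV : V₂ ≤ V₁ := ENNReal.toReal_mono hfin₁ (g.vol_mono hB₂B₁)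
  -- integrability of `|R|` on `B₁` (inside the compact closed ball)
  have hRint : IntegrableOn (fun y ↦ |g.scalarCurvature y|) B₁ g.riemVolume :=
    ((continuous_abs.comp hRc).continuousOn.integrableOn_compact (hc x s'.toNNReal)).mono_set
      (ball_subset_closedBall_of_complete hg x s')
  -- Lemma 8.3.5 (compact-support form) at `τ = s'²/36`, `K = C₁/s'²`
  have hτ : 0 < 1 / 36 * s' ^ 2 := by positivity
  have hL := h835 (𝓡 n) M g hg (fun y ↦ g.scalarCurvature y) hRc x s' (1 / 36 * s' ^ 2)
    (C₁ / s' ^ 2) hs' hτ χ hχs hχc hχ0 hχ1 hχB hχsupp hχK' hfin₁ hRint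
  rw [hfr] at hL
  -- the LSI at scale `τ` tested on `χ`
  have hZpos : 0 < ∫ y, χ y ^ 2 ∂g.riemVolume := by
    have hχcont : Continuous χ := hχs.continuous
    have hint : Integrable (fun y ↦ χ y ^ 2) g.riemVolume := by
      have h2 : Integrable (fun y ↦ χ y * χ y) g.riemVolume :=
        (hχcont.mul hχcont).integrable_of_hasCompactSupport hχc.mul_right
      simpa only [sq] using h2
    have h1 : V₂ ≤ ∫ y, χ y ^ 2 ∂g.riemVolume := by
      have hB₂m : MeasurableSet B₂ := (PseudoRiemannianMetric.isOpen_ball hg x _).measurableSet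
      calc V₂ = ∫ y in B₂, (1 : ℝ) ∂g.riemVolume := by
            rw [setIntegral_const, smul_eq_mul, mul_one]; rfl
        _ = ∫ y in B₂, χ y ^ 2 ∂g.riemVolume :=
            setIntegral_congr_fun hB₂m (fun y hy ↦ by rw [hχB y hy]; norm_num)
        _ ≤ ∫ y, χ y ^ 2 ∂g.riemVolume :=
            setIntegral_le_integral hint (Eventually.of_forall fun y ↦ sq_nonneg _)
    exact hV₂pos.trans_le h1
  have hlsi := hLSI n M g f hg hc hf hsol hnorm (1 / 36 * s' ^ 2) hτ χ hχs hχc hZpos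
  -- `∫_{B₁} |R| ≤ A V₁`
  have hJ : ∫ y in B₁, |g.scalarCurvature y| ∂g.riemVolume ≤ A * V₁ := by
    have hB₁m : MeasurableSet B₁ := (PseudoRiemannianMetric.isOpen_ball hg x _).measurableSet
    have hconst : IntegrableOn (fun _ : M ↦ A) B₁ g.riemVolume :=
      integrableOn_const (by exact hfin₁)
    calc ∫ y in B₁, |g.scalarCurvature y| ∂g.riemVolume ≤ ∫ y in B₁, A ∂g.riemVolume :=
          setIntegral_mono_on hRint hconst hB₁m (fun y _ ↦ by
            rw [abs_of_nonneg (hR0 y)]; exact hA y)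
      _ = A * V₁ := by rw [setIntegral_const, smul_eq_mul, mul_comm]; rfl
  -- doubling in `ℝ`
  have hdoub' : V₁ ≤ 2 ^ (n + 1) * V₂ := by
    have := ENNReal.toReal_mono (ENNReal.mul_ne_top (by simp) hfin₂) hdoub
    simpa [hV₁, hV₂, ENNReal.toReal_mul, ENNReal.toReal_pow] using this
  -- the entropy estimate `m ≤ …` and the real-variable core
  have hent : m ≤ C₁ / 9 * ((V₁ - V₂) / V₂) + 1 / 36 * s' ^ 2 / V₂ *
      (∫ y in B₁, |g.scalarCurvature y| ∂g.riemVolume) +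
      Real.log (V₁ / (4 * Real.pi * (1 / 36 * s' ^ 2)) ^ ((n : ℝ) / 2)) - n := by
    have ha : 4 * (1 / 36 * s' ^ 2) * (C₁ / s' ^ 2) = C₁ / 9 := by
      field_simp
      ring
    have h := hlsi.trans hL
    rw [ha] at h
    simpa [hm, hV₁, hV₂, hB₁, hB₂, div_eq_mul_inv, mul_comm, mul_left_comm, mul_assoc] using h
  have hkey := mul_pow_le_of_entropy_estimate_sup n hs' hs'1 hV₂pos hV (by positivity) hA0 hent
    hJ hdoub'
  exact ENNReal.ofReal_le_of_le_toReal hkey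

/-- **The registered conditional stub** `helper_shrinkerNoncollapsing_of` (its Lemma-8.3.5
antecedent asserts the bound for every continuous `S`, without the integrability of `|S|` on the
ball — a stronger hypothesis than the one used): immediate from
`helper_shrinkerNoncollapsing_of_integrable`. [cite: Topping2006, §8.3, Thm. 8.3.1] -/
theorem helper_shrinkerNoncollapsing_of : (∃ C₀ : ℝ, ∀ {E : Type} [NormedAddCommGroup E] [NormedSpace ℝ E] [FiniteDimensional ℝ E] {H : Type} [TopologicalSpace H] (I : ModelWithCorners ℝ E H) [I.Boundaryless] (M : Type) [TopologicalSpace M] [T2Space M] [LocallyCompactSpace M] [SigmaCompactSpace M] [T3Space M] [ChartedSpace H M] [IsManifold I ∞ M] (g : PseudoRiemannianMetric I ∞ E (TangentSpace I : M → Type _)) (hg : g.IsRiemannian), (∀ (x : M) (r : NNReal), IsCompact {y : M | g.edist hg x y ≤ r}) → ∀ (p : M) (s : ℝ), 0 < s → ∃ χ : M → ℝ, ContMDiff I 𝓘(ℝ, ℝ) ∞ χ ∧ HasCompactSupport χ ∧ (∀ x, 0 ≤ χ x) ∧ (∀ x, χ x ≤ 1) ∧ (∀ x ∈ g.ball p (ENNReal.ofReal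 (s / 2)), χ x = 1) ∧ tsupport χ ⊆ g.ball p (ENNReal.ofReal s) ∧ ∀ x, g.gradSq χ x ≤ C₀ / s ^ 2) → (∀ (n : ℕ) (M : Type) [TopologicalSpace M] [T2Space M] [SecondCountableTopology M] [ChartedSpace (EuclideanSpace ℝ (Fin n)) M] [IsManifold (𝓡 n) ∞ M] [ConnectedSpace M] [T3Space M] [MeasurableSpace M] [BorelSpace M] (g : PseudoRiemannianMetric (𝓡 n) ∞ (EuclideanSpace ℝ (Fin n)) (TangentSpace (𝓡 n) : M → Type _)) [g.HasLeviCivita] (f : M → ℝ) (hg : g.IsRiemannian), (∀ (x : M) (r : NNReal), IsCompact {y : M | g.edist hg x y ≤ r}) → ContMDiff (𝓡 n) 𝓘(ℝ, ℝ) ∞ f → (∀ (x : M) (X Y : TangentSpace (𝓡 n) x), g.ricci x X Y + g.hessian f x X Y = (1 / 2 : ℝ) * g.val x X Y) → (∀ x : M, g.scalarCurvature x + g.gradSq f x = f x) → ∀ τ : ℝ, 0 < τ → ∀ w : M → ℝ, ContMDiff (𝓡 n) 𝓘(ℝ, ℝ) ∞ w → HasCompactSupport w → 0 < ∫ x, w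 x ^ 2 ∂g.riemVolume → Real.log ((4 * Real.pi) ^ (-(n : ℝ) / 2) * ∫ x, Real.exp (-f x) ∂g.riemVolume) ≤ (∫ x, (τ * (g.scalarCurvature x * w x ^ 2 + 4 * g.gradSq w x) - w x ^ 2 * Real.log (w x ^ 2)) ∂g.riemVolume) / (∫ x, w x ^ 2 ∂g.riemVolume) + Real.log (∫ x, w x ^ 2 ∂g.riemVolume) + Real.log ((4 * Real.pi * τ) ^ (-(n : ℝ) / 2)) - n) → (∀ {E : Type} [NormedAddCommGroup E] [NormedSpace ℝ E] [FiniteDimensional ℝ E] {H : Type} [TopologicalSpace H] (I : ModelWithCorners ℝ E H) (M : Type) [TopologicalSpace M] [T2Space M] [ChartedSpace H M] [IsManifold I ∞ M] [T3Space M] [MeasurableSpace M] [BorelSpace M] (g : PseudoRiemannianMetric I ∞ E (TangentSpace I : M → Type _)) (hg : g.IsRiemannian) (S : M → ℝ), Continuous S → ∀ (p : M) (r τ K : ℝ), 0 < r → 0 < τ → ∀ χ : M → ℝ, ContMDiff I 𝓘(ℝ, ℝ) ∞ χ → HasCompactSupport χ → (∀ x, 0 ≤ χ x) → (∀ x, χ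 x ≤ 1) → (∀ x ∈ g.ball p (ENNReal.ofReal (r / 2)), χ x = 1) → tsupport χ ⊆ g.ball p (ENNReal.ofReal r) → (∀ x, g.gradSq χ x ≤ K) → g.vol (g.ball p (ENNReal.ofReal r)) ≠ ⊤ → (∫ x, (τ * (S x * χ x ^ 2 + 4 * g.gradSq χ x) - χ x ^ 2 * Real.log (χ x ^ 2)) ∂g.riemVolume) / (∫ x, χ x ^ 2 ∂g.riemVolume) + Real.log (∫ x, χ x ^ 2 ∂g.riemVolume) + Real.log ((4 * Real.pi * τ) ^ (-(finrank ℝ E : ℝ) / 2)) - finrank ℝ E ≤ 4 * τ * K * ((((g.vol (g.ball p (ENNReal.ofReal r))).toReal - (g.vol (g.ball p (ENNReal.ofReal (r / 2)))).toReal)) / (g.vol (g.ball p (ENNReal.ofReal (r / 2)))).toReal) + τ / (g.vol (g.ball p (ENNReal.ofReal (r / 2)))).toReal * ∫ x in g.ball p (ENNReal.ofReal r), |S x| ∂g.riemVolume + Real.log ((g.vol (g.ball p (ENNReal.ofReal r))).toReal / (4 * Real.pi * τ) ^ ((finrank ℝ E : ℝ) / 2)) - finrank ℝ E) → ∀ (n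 : ℕ) (M : Type) [TopologicalSpace M] [T2Space M] [SecondCountableTopology M] [ChartedSpace (EuclideanSpace ℝ (Fin n)) M] [IsManifold (𝓡 n) ∞ M] [ConnectedSpace M] [T3Space M] [MeasurableSpace M] [BorelSpace M] (g : PseudoRiemannianMetric (𝓡 n) ∞ (EuclideanSpace ℝ (Fin n)) (TangentSpace (𝓡 n) : M → Type _)) [g.HasLeviCivita] (f : M → ℝ) (hg : g.IsRiemannian), (∀ (x : M) (r : NNReal), IsCompact {y : M | g.edist hg x y ≤ r}) → ContMDiff (𝓡 n) 𝓘(ℝ, ℝ) ∞ f → (∀ (x : M) (X Y : TangentSpace (𝓡 n) x), g.ricci x X Y + g.hessian f x X Y = (1 / 2 : ℝ) * g.val x X Y) → (∀ x : M, g.scalarCurvature x + g.gradSq f x = f x) → ∀ A : ℝ, (∀ x : M, g.scalarCurvature x ≤ A) → ∃ κ : ℝ, 0 < κ ∧ ∀ (x : M) (s : ℝ), 0 < s → s ≤ 1 → ENNReal.ofReal (κ * s ^ n) ≤ g.vol (g.ball x (ENNReal.ofReal s)) :=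
  fun hcut hLSI h835 ↦ helper_shrinkerNoncollapsing_of_integrable hcut hLSI
    (fun I M _ _ _ _ _ _ _ g hg S hS p r τ K hr hτ χ hχs hχc hχ0 hχ1 hχB hχsupp hχK hfin _ ↦
      h835 I M g hg S hS p r τ K hr hτ χ hχs hχc hχ0 hχ1 hχB hχsupp hχK hfin)

/-- **Perelman's `κ`-noncollapsing of a complete gradient shrinking soliton with bounded scalar
curvature, uniform in the base point, at all scales `≤ 1`** (the registered stub
`helper_shrinkerNoncollapsing` of crux stmt-SmoothPoincare4-10868, line `collapsed-ends-usc`; input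
"non-collapsing" of the printed chain of `ShrinkerSplittingAtInfinity`, stmt-16588). For a complete
connected `n`-dimensional gradient shrinker `Ric + Hess f = g/2`, `R + |∇f|² = f`, with `R ≤ A`:
`∃ κ > 0, ∀ x, ∀ s ∈ (0, 1], κ sⁿ ≤ Vol_g B(x, s)`. All inputs are theorems: the cut-offs
(`helper_metricCutoffComplete_of helper_lipschitzSmoothingCompactSupport`), the LSI at all scales
(`helper_csLSI_allScales`, from Li–Wang 2020 Thm. 1.1 discharged in the tree) and Lemma 8.3.5
(`helper_csEntropy_cutoff_le_of_integrableOn`).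
[cite: Perelman2002, §4, Thm. 4.1] [cite: LiWang2020, Thm. 1.1] [cite: Topping2006, §8.3, Thm. 8.3.1] -/
theorem helper_shrinkerNoncollapsing : ∀ (n : ℕ) (M : Type) [TopologicalSpace M] [T2Space M] [SecondCountableTopology M] [ChartedSpace (EuclideanSpace ℝ (Fin n)) M] [IsManifold (𝓡 n) ∞ M] [ConnectedSpace M] [T3Space M] [MeasurableSpace M] [BorelSpace M] (g : PseudoRiemannianMetric (𝓡 n) ∞ (EuclideanSpace ℝ (Fin n)) (TangentSpace (𝓡 n) : M → Type _)) [g.HasLeviCivita] (f : M → ℝ) (hg : g.IsRiemannian), (∀ (x : M) (r : NNReal), IsCompact {y : M | g.edist hg x y ≤ r}) → ContMDiff (𝓡 n) 𝓘(ℝ, ℝ) ∞ f → (∀ (x : M) (X Y : TangentSpace (𝓡 n) x), g.ricci x X Y + g.hessian f x X Y = (1 / 2 : ℝ) * g.val x X Y) → (∀ x : M, g.scalarCurvature x + g.gradSq f x = f x) → ∀ A : ℝ, (∀ x : M, g.scalarCurvature x ≤ A) → ∃ κ : ℝ, 0 < κ ∧ ∀ (x : M) (s : ℝ), 0 < s →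 s ≤ 1 → ENNReal.ofReal (κ * s ^ n) ≤ g.vol (g.ball x (ENNReal.ofReal s)) :=
  helper_shrinkerNoncollapsing_of_integrable
    (helper_metricCutoffComplete_of helper_lipschitzSmoothingCompactSupport)
    helper_csLSI_allScales helper_csEntropy_cutoff_le_of_integrableOn

end Summit.SmoothPoincare4.SmoothPoincare4.Theorems.NoncompactShrinkerGapNoncollapsing

end
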